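import Summits.KontsevichZagierPeriods.KontsevichZagierPeriods.Theorems.PlanarK0Injective.Negative.Kit
import Literature.NumberTheory.Transcendental.SemialgebraicMapsProofs

/-!
# `PlanarCompiler` (stmt-KontsevichZagierPeriods-10058), line `twist-restoring-shear` — Green bookkeeping II

Helper file for the lead's stub `stub_greenAssembly` (crux protocol, `--supports`):

* `green_swap` — the Green datum `(A, B, S)` on the standard triangle transported along the
  coordinate swap `p ↦ p ∘ Equiv.swap 0 1`: `(B ∘ swap, A ∘ swap, S ∘ swap)` is again a Green datum
  (semialgebraicity, continuity on the closed triangle, and the potential by the chain rule);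
* `exists_rep_comp_of_continuousOn` — 1-dimensional representations `[∫₀¹ f(φ t) dt]` for `f`
  continuous and `ℚ`-semialgebraic on the closed triangle and a continuous `ℚ`-semialgebraic map
  `φ : (0,1) → Δ` (bounded continuous integrands are integrable);
* `int_sign_eq` — two signs `ε, ε' ∈ {1, −1, 0}` certified by the same real number agree;
* `sum_strips_telescope` — the purely combinatorial telescoping of stacked cells over strips.

No new definitions. [Kontsevich–Zagier 2001, §1.2; folklore]
-/

noncomputable section

open MeasureTheory Set MvPolynomial
open Literature.NumberTheory.Transcendental Literature.ModelTheory.ExponentialFields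

namespace Summit.KontsevichZagierPeriods.SymplecticScissors.PlanarCompilerProof

/-! ## The coordinate swap -/

/-- The coordinate swap of `ℝ²` as a continuous linear map. [folklore] -/
theorem swap_clm_apply (v : Fin 2 → ℝ) :
    (ContinuousLinearMap.pi fun i : Fin 2 =>
      (ContinuousLinearMap.proj ((Equiv.swap (0 : Fin 2) 1) i) : (Fin 2 → ℝ) →L[ℝ] ℝ)) v =
      v ∘ (Equiv.swap (0 : Fin 2) 1) := by
  ext i; simp

/-- The closed standard triangle is invariant under the coordinate swap. [folklore] -/
theorem swap_mem_triangle {p : Fin 2 → ℝ} (hp : p ∈ {p : Fin 2 → ℝ | 0 ≤ p 0 ∧ 0 ≤ p 1 ∧ p 0 + p 1 ≤ 1}) :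
    p ∘ (Equiv.swap (0 : Fin 2) 1) ∈ {p : Fin 2 → ℝ | 0 ≤ p 0 ∧ 0 ≤ p 1 ∧ p 0 + p 1 ≤ 1} := by
  simp only [mem_setOf_eq, Function.comp_apply, Equiv.swap_apply_left, Equiv.swap_apply_right] at hp ⊢
  exact ⟨hp.2.1, hp.1, by linarith [hp.2.2]⟩

/-- The coordinate swap is a `ℚ`-semialgebraic map (a polynomial map) on every `ℚ`-semialgebraic set.
[folklore] -/
theorem isSemialgebraicMapOn_swap {s : Set (Fin 2 → ℝ)} (hs : IsSemialgebraic ℚ s) :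
    IsSemialgebraicMapOn ℚ s (fun p : Fin 2 → ℝ => p ∘ (Equiv.swap (0 : Fin 2) 1)) := by
  refine (isSemialgebraicMapOn_aeval hs ![X 1, X 0]).congr ?_
  intro p _; ext i; fin_cases i <;> simp

/-- **Swapping a Green datum.** If `(A, B, S)` is a Green datum on the standard triangle
(`A, B` `ℚ`-semialgebraic and continuous on the closed triangle, `dS = A da + B db` on the open
triangle), then so is `(B ∘ swap, A ∘ swap, S ∘ swap)`. [folklore; chain rule] -/
theorem green_swap {A B S : (Fin 2 → ℝ) → ℝ}
    (hA : IsSemialgebraicFunOn ℚ {p : Fin 2 → ℝ | 0 ≤ p 0 ∧ 0 ≤ p 1 ∧ p 0 + p 1 ≤ 1} A)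
    (hB : IsSemialgebraicFunOn ℚ {p : Fin 2 → ℝ | 0 ≤ p 0 ∧ 0 ≤ p 1 ∧ p 0 + p 1 ≤ 1} B)
    (hAc : ContinuousOn A {p : Fin 2 → ℝ | 0 ≤ p 0 ∧ 0 ≤ p 1 ∧ p 0 + p 1 ≤ 1})
    (hBc : ContinuousOn B {p : Fin 2 → ℝ | 0 ≤ p 0 ∧ 0 ≤ p 1 ∧ p 0 + p 1 ≤ 1})
    (hS : ∀ p : Fin 2 → ℝ, 0 < p 0 → 0 < p 1 → p 0 + p 1 < 1 →
      HasFDerivAt S (A p • (ContinuousLinearMap.proj 0 : (Fin 2 → ℝ) →L[ℝ] ℝ) +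
        B p • (ContinuousLinearMap.proj 1 : (Fin 2 → ℝ) →L[ℝ] ℝ)) p) :
    IsSemialgebraicFunOn ℚ {p : Fin 2 → ℝ | 0 ≤ p 0 ∧ 0 ≤ p 1 ∧ p 0 + p 1 ≤ 1}
        (B ∘ fun p : Fin 2 → ℝ => p ∘ (Equiv.swap (0 : Fin 2) 1)) ∧
      IsSemialgebraicFunOn ℚ {p : Fin 2 → ℝ | 0 ≤ p 0 ∧ 0 ≤ p 1 ∧ p 0 + p 1 ≤ 1}
        (A ∘ fun p : Fin 2 → ℝ => p ∘ (Equiv.swap (0 : Fin 2) 1)) ∧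
      ContinuousOn (B ∘ fun p : Fin 2 → ℝ => p ∘ (Equiv.swap (0 : Fin 2) 1))
        {p : Fin 2 → ℝ | 0 ≤ p 0 ∧ 0 ≤ p 1 ∧ p 0 + p 1 ≤ 1} ∧
      ContinuousOn (A ∘ fun p : Fin 2 → ℝ => p ∘ (Equiv.swap (0 : Fin 2) 1))
        {p : Fin 2 → ℝ | 0 ≤ p 0 ∧ 0 ≤ p 1 ∧ p 0 + p 1 ≤ 1} ∧
      (∀ p : Fin 2 → ℝ, 0 < p 0 → 0 < p 1 → p 0 + p 1 < 1 →
        HasFDerivAt (S ∘ fun p : Fin 2 → ℝ => p ∘ (Equiv.swap (0 : Fin 2) 1))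
          ((B ∘ fun p : Fin 2 → ℝ => p ∘ (Equiv.swap (0 : Fin 2) 1)) p •
              (ContinuousLinearMap.proj 0 : (Fin 2 → ℝ) →L[ℝ] ℝ) +
            (A ∘ fun p : Fin 2 → ℝ => p ∘ (Equiv.swap (0 : Fin 2) 1)) p •
              (ContinuousLinearMap.proj 1 : (Fin 2 → ℝ) →L[ℝ] ℝ)) p) := by
  set Δ : Set (Fin 2 → ℝ) := {p : Fin 2 → ℝ | 0 ≤ p 0 ∧ 0 ≤ p 1 ∧ p 0 + p 1 ≤ 1} with hΔ
  set sw : (Fin 2 → ℝ) → (Fin 2 → ℝ) := fun p => p ∘ (Equiv.swap (0 : Fin 2) 1) with hsw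
  have hΔs : IsSemialgebraic ℚ Δ := IsSemialgebraicFunOn.isSemialgebraic_holds hA
  have hmaps : MapsTo sw Δ Δ := fun p hp => swap_mem_triangle hp
  have hswc : Continuous sw := continuous_pi fun i => continuous_apply _
  have hswS : IsSemialgebraicMapOn ℚ Δ sw := isSemialgebraicMapOn_swap hΔs
  refine ⟨IsSemialgebraicFunOn.comp_isSemialgebraicMapOn_holds hB hswS hmaps,
    IsSemialgebraicFunOn.comp_isSemialgebraicMapOn_holds hA hswS hmaps,
    hBc.comp hswc.continuousOn hmaps, hAc.comp hswc.continuousOn hmaps, ?_⟩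
  intro p h0 h1 h2
  -- the swap as a continuous linear map
  set L : (Fin 2 → ℝ) →L[ℝ] (Fin 2 → ℝ) := ContinuousLinearMap.pi fun i : Fin 2 =>
    (ContinuousLinearMap.proj ((Equiv.swap (0 : Fin 2) 1) i) : (Fin 2 → ℝ) →L[ℝ] ℝ) with hL
  have hLsw : (L : (Fin 2 → ℝ) → (Fin 2 → ℝ)) = sw := by
    funext v; rw [hL, swap_clm_apply]
  have hswp : sw p = ![p 1, p 0] := by
    ext i; fin_cases i <;> simp [hsw]
  have hq : HasFDerivAt S (A (sw p) • (ContinuousLinearMap.proj 0 : (Fin 2 → ℝ) →L[ℝ] ℝ) +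
      B (sw p) • (ContinuousLinearMap.proj 1 : (Fin 2 → ℝ) →L[ℝ] ℝ)) (sw p) := by
    have := hS (sw p) (by simp [hswp, h1]) (by simp [hswp, h0])
      (by simp only [hswp, Matrix.cons_val_zero, Matrix.cons_val_one]; linarith)
    exact this
  have hcomp : HasFDerivAt (S ∘ sw) ((A (sw p) • (ContinuousLinearMap.proj 0 : (Fin 2 → ℝ) →L[ℝ] ℝ) +
      B (sw p) • (ContinuousLinearMap.proj 1 : (Fin 2 → ℝ) →L[ℝ] ℝ)).comp L) p := by
    have hL' : HasFDerivAt sw L p := by rw [← hLsw]; exact L.hasFDerivAt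
    exact hq.comp p hL'
  have hEq : (A (sw p) • (ContinuousLinearMap.proj 0 : (Fin 2 → ℝ) →L[ℝ] ℝ) +
      B (sw p) • (ContinuousLinearMap.proj 1 : (Fin 2 → ℝ) →L[ℝ] ℝ)).comp L =
      (B ∘ sw) p • (ContinuousLinearMap.proj 0 : (Fin 2 → ℝ) →L[ℝ] ℝ) +
        (A ∘ sw) p • (ContinuousLinearMap.proj 1 : (Fin 2 → ℝ) →L[ℝ] ℝ) := by
    refine ContinuousLinearMap.ext fun v => ?_
    have hLv : L v = sw v := congr_fun hLsw v
    simp only [ContinuousLinearMap.comp_apply, hLv]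
    simp [hsw]
    ring
  rw [hEq] at hcomp
  exact hcomp

/-! ## Trace representations on the unit interval -/

/-- **Bounded continuous traces are representations.** For `f` continuous and `ℚ`-semialgebraic
on the closed standard triangle `Δ` and a continuous `ℚ`-semialgebraic map `φ` of the open unit
interval into `Δ`, `t ↦ f (φ t)` is the integrand of a 1-dimensional representation on `(0,1)`.
[Kontsevich–Zagier 2001, §1.1; folklore] -/
theorem exists_rep_comp_of_continuousOn {f : (Fin 2 → ℝ) → ℝ}
    (hf : IsSemialgebraicFunOn ℚ {p : Fin 2 → ℝ | 0 ≤ p 0 ∧ 0 ≤ p 1 ∧ p 0 + p 1 ≤ 1} f)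
    (hfc : ContinuousOn f {p : Fin 2 → ℝ | 0 ≤ p 0 ∧ 0 ≤ p 1 ∧ p 0 + p 1 ≤ 1})
    {φ : (Fin 1 → ℝ) → (Fin 2 → ℝ)}
    (hφ : IsSemialgebraicMapOn ℚ {z : Fin 1 → ℝ | z 0 ∈ Ioo (0 : ℝ) 1} φ) (hφc : Continuous φ)
    (hmaps : MapsTo φ {z : Fin 1 → ℝ | z 0 ∈ Ioo (0 : ℝ) 1}
      {p : Fin 2 → ℝ | 0 ≤ p 0 ∧ 0 ≤ p 1 ∧ p 0 + p 1 ≤ 1}) :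
    ∃ ρ : KZ.IntegralRep 1, ρ.domain = {z : Fin 1 → ℝ | z 0 ∈ Ioo (0 : ℝ) 1} ∧ ρ.integrand = f ∘ φ := by
  set U : Set (Fin 1 → ℝ) := {z : Fin 1 → ℝ | z 0 ∈ Ioo (0 : ℝ) 1} with hU
  set Δ : Set (Fin 2 → ℝ) := {p : Fin 2 → ℝ | 0 ≤ p 0 ∧ 0 ≤ p 1 ∧ p 0 + p 1 ≤ 1} with hΔ
  have hUpi : U = Set.pi univ fun _ : Fin 1 => Ioo (0 : ℝ) 1 := by
    ext z; simp [hU, Fin.forall_fin_one]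
  have hUs : IsSemialgebraic ℚ U := IsSemialgebraicMapOn.isSemialgebraic_holds hφ
  have hUm : MeasurableSet U := IsSemialgebraic.measurableSet_holds hUs
  have hUvol : volume U < ⊤ := by
    rw [hUpi, volume_pi_pi]; simp
  -- compactness of the closed triangle and a bound for `f`
  have hΔc : IsCompact Δ := by
    have hclosed : IsClosed Δ := by
      have h0 : IsClosed {p : Fin 2 → ℝ | 0 ≤ p 0} := isClosed_le continuous_const (continuous_apply 0)
      have h1 : IsClosed {p : Fin 2 → ℝ | 0 ≤ p 1} := isClosed_le continuous_const (continuous_apply 1)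
      have h2 : IsClosed {p : Fin 2 → ℝ | p 0 + p 1 ≤ 1} :=
        isClosed_le ((continuous_apply 0).add (continuous_apply 1)) continuous_const
      have : Δ = {p : Fin 2 → ℝ | 0 ≤ p 0} ∩ {p | 0 ≤ p 1} ∩ {p | p 0 + p 1 ≤ 1} := by
        ext p; simp [hΔ, and_assoc]
      rw [this]; exact (h0.inter h1).inter h2
    have hbdd : Bornology.IsBounded Δ := by
      refine (Metric.isBounded_Icc (0 : Fin 2 → ℝ) 1).subset ?_
      intro p hp
      simp only [hΔ, mem_setOf_eq] at hp
      refine ⟨fun i => ?_, fun i => ?_⟩ <;> fin_cases i <;> simp <;> linarith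
    exact Metric.isCompact_of_isClosed_isBounded hclosed hbdd
  obtain ⟨C, hC⟩ := hΔc.exists_bound_of_continuousOn hfc
  refine ⟨⟨U, f ∘ φ, hUs, IsSemialgebraicFunOn.comp_isSemialgebraicMapOn_holds hf hφ hmaps, ?_⟩,
    rfl, rfl⟩
  refine IntegrableOn.of_bound hUvol ?_ C ?_
  · exact ((hfc.comp hφc.continuousOn hmaps).aestronglyMeasurable hUm)
  · rw [ae_restrict_iff' hUm]
    exact Filter.Eventually.of_forall fun z hz => hC _ (hmaps hz)

/-! ## Signs -/

/-- Two signs `ε, ε' ∈ {1, −1, 0}` both certified by the sign of the same real number `d` agree.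
[folklore] -/
theorem int_sign_eq {ε ε' : ℤ} {d : ℝ} (hε : ε = 1 ∨ ε = -1 ∨ ε = 0) (hε' : ε' = 1 ∨ ε' = -1 ∨ ε' = 0)
    (h1 : ε ≠ 0 → 0 < (ε : ℝ) * d) (h2 : ε = 0 → d = 0)
    (h1' : ε' ≠ 0 → 0 < (ε' : ℝ) * d) (h2' : ε' = 0 → d = 0) : ε = ε' := by
  rcases hε with rfl | rfl | rfl <;> rcases hε' with rfl | rfl | rfl
  · rfl
  · have a := h1 (by norm_num); have b := h1' (by norm_num); push_cast at a b; linarith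
  · have a := h1 (by norm_num); have b := h2' rfl; push_cast at a; rw [b] at a; linarith
  · have a := h1 (by norm_num); have b := h1' (by norm_num); push_cast at a b; linarith
  · rfl
  · have a := h1 (by norm_num); have b := h2' rfl; push_cast at a; rw [b] at a; linarith
  · have a := h1' (by norm_num); have b := h2 rfl; push_cast at a; rw [b] at a; linarith
  · have a := h1' (by norm_num); have b := h2 rfl; push_cast at a; rw [b] at a; linarith
  · rfl

/-! ## Telescoping over strips -/

/-- **Telescoping of stacked cells.** Cells `i : Fin m` are arranged in strips `str i : Fin k` at
levels `lev i < L (str i)`, each pair `(strip, level)` occurring exactly once; to each cell are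
attached a lower value `u i` and an upper value `v i` in an additive commutative group such that
consecutive cells of a strip share their value (`u j = v i` when `lev j = lev i + 1`), the bottom
cell carries `b (str i)` and the top cell `t (str i)`. Then `∑ i, (v i − u i) = ∑ j, (t j − b j)`.
[folklore] -/
theorem sum_strips_telescope {M : Type*} [AddCommGroup M] {k m : ℕ} (str : Fin m → Fin k)
    (lev : Fin m → ℕ) (L : Fin k → ℕ) (hlev : ∀ i, lev i < L (str i))
    (hinj : ∀ i j, str i = str j → lev i = lev j → i = j)
    (hsurj : ∀ (j : Fin k) (l : ℕ), l < L j → ∃ i, str i = j ∧ lev i = l) (hL : ∀ j, 0 < L j)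
    (u v : Fin m → M) (b t : Fin k → M)
    (hshare : ∀ i j, str i = str j → lev j = lev i + 1 → u j = v i)
    (hbot : ∀ i, lev i = 0 → u i = b (str i)) (htop : ∀ i, lev i + 1 = L (str i) → v i = t (str i)) :
    ∑ i, (v i - u i) = ∑ j, (t j - b j) := by
  classical
  -- regroup by strips
  rw [← Finset.sum_fiberwise Finset.univ str (fun i => v i - u i)]
  refine Finset.sum_congr rfl fun j _ => ?_
  -- enumerate the strip `j` by levels
  choose idx hidx using fun l : {l : ℕ // l < L j} => hsurj j l.1 l.2
  let ι : ℕ → Fin m := fun l => if h : l < L j then idx ⟨l, h⟩ else idx ⟨0, hL j⟩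
  have hι : ∀ l, l < L j → str (ι l) = j ∧ lev (ι l) = l := fun l hl => by
    simp only [ι, dif_pos hl]; exact hidx ⟨l, hl⟩
  have hfib : (Finset.univ.filter fun i => str i = j) = (Finset.range (L j)).image ι := by
    ext i
    simp only [Finset.mem_filter, Finset.mem_univ, true_and, Finset.mem_image, Finset.mem_range]
    constructor
    · intro hi
      refine ⟨lev i, hi ▸ hlev i, hinj _ _ ((hι _ (hi ▸ hlev i)).1.trans hi.symm)
        (hι _ (hi ▸ hlev i)).2⟩
    · rintro ⟨l, hl, rfl⟩; exact (hι l hl).1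
  have hιinj : Set.InjOn ι (Finset.range (L j) : Set ℕ) := by
    intro l hl l' hl' h
    have h1 := (hι l (Finset.mem_range.mp hl)).2
    have h2 := (hι l' (Finset.mem_range.mp hl')).2
    rw [h] at h1; exact h1.symm.trans h2
  rw [hfib, Finset.sum_image hιinj]
  -- telescope
  let g : ℕ → M := fun l => if l < L j then u (ι l) else t j
  have hstep : ∀ l ∈ Finset.range (L j), v (ι l) - u (ι l) = g (l + 1) - g l := by
    intro l hl
    have hl' := Finset.mem_range.mp hl
    have hgl : g l = u (ι l) := by simp only [g, if_pos hl']
    have hgl1 : g (l + 1) = v (ι l) := by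
      by_cases h : l + 1 < L j
      · simp only [g, if_pos h]
        exact hshare (ι l) (ι (l + 1)) ((hι l hl').1.trans (hι (l + 1) h).1.symm)
          (by rw [(hι l hl').2, (hι (l + 1) h).2])
      · simp only [g, if_neg h]
        have hEq : l + 1 = L j := by omega
        have ht := htop (ι l) (by rw [(hι l hl').2, (hι l hl').1]; exact hEq)
        rw [ht, (hι l hl').1]
    rw [hgl, hgl1]
  rw [Finset.sum_congr rfl hstep, Finset.sum_range_sub]
  have hg0 : g 0 = b j := by
    simp only [g, if_pos (hL j)]
    rw [hbot (ι 0) (hι 0 (hL j)).2, (hι 0 (hL j)).1]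
  have hgL : g (L j) = t j := by simp only [g, lt_irrefl, if_false]
  rw [hg0, hgL]

/-- Registered anchor of this helper file (crux protocol `--supports`): telescoping over strips (`sum_strips_telescope`) in `FormalRep`. [folklore] -/
theorem stub_greenAux2 :
    ∀ (k m : ℕ) (str : Fin m → Fin k) (lev : Fin m → ℕ) (L : Fin k → ℕ), (∀ i, lev i < L (str i)) → (∀ i j, str i = str j → lev i = lev j → i = j) → (∀ (j : Fin k) (l : ℕ), l < L j → ∃ i, str i = j ∧ lev i = l) → (∀ j, 0 < L j) → ∀ (u v : Fin m → KZ.FormalRep) (b t : Fin k → KZ.FormalRep), (∀ i j, str i = str j → lev j = lev i + 1 → u j = v i) → (∀ i, lev i = 0 → u i = b (str i)) → (∀ i, lev i + 1 = L (str i) → v i = t (str i)) → ∑ i, (v i - u i) = ∑ j, (t j - b j) :=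
  fun _ _ str lev L a b c d u v bb tt e f g => sum_strips_telescope str lev L a b c d u v bb tt e f g

end Summit.KontsevichZagierPeriods.SymplecticScissors.PlanarCompilerProof
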